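import Mathlib
import HarnessLib
import HarnessLib.Audit
import Summits.Langlands.Statement

/-!
Route: PicardBranchPoint

CLOSED (retired) 2026-08-15T13:48:44Z by operator:999:1257524 — reason: not-a-thesis: assembly does not conclude the sub-problem Statement — note: D-0027 §2.1 audit (human 2026-08-15: routes that do not decide the summit are removed): the assembly concludes `PicardAutomorphy`, not the sub-problem statement; a NEW conforming route may be opened from the same idea (generated `closes : … → _root_.Langlands`).. The file is kept as the record of this route; refuted decls are indexed as negative knowledge (`ledger negatives`).

# Route PicardBranchPoint — Picard curves are automorphic over Q(omega) — free S4=PGL2(F3) residual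
automorphy at the ramified prime 3, then irregular-weight lifting on the Picard modular surface

It suffices to show X = "generic Picard curves over ℚ are automorphic over K = ℚ(ω)": for every f ∈
ℤ[X] of degree 4,
separable, with Gal(f) ∈ {A₄, S₄} (⇔ 12 ∣ #Gal), the Picard curve C : y³ = f(x) has a cuspidal,
L-algebraic automorphic
representation π of GL₃(𝔸_K) whose Satake traces at almost all finite places 𝔭 of K equal (under a
complex embedding e of K)
the Picard trace a_𝔭(f) = −Σ_{x ∈ k_𝔭} χ_𝔭(f(x)) — the trace of geometric Frobenius on the ω-part of
H¹(C), written with the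
cubic residue symbol χ_𝔭 of ℤ[ω] (inlined; independent of the choice of primitive cube root ζ, which
is therefore universally
quantified). This realises idea card picard-branch-point-residual (its P1–P5) as a (B)-slice of the
summit: X is the family of
instances of `Summit.Langlands.GaloisToAutomorphic 3` over ℚ(ω) for the λ-adic representations of
Picard curves, in the
a.e.-Satake form of the accepted lang.S03/lang.S28
(`Literature.NumberTheory.Automorphic.FontaineMazurLanglandsGLn`,
`potentiallyModular_ellipticCurve_CM`), with the summit's m = 1 convention (geometric Frobenius
eigenvalues = Satake
parameters of the L-algebraic π). X is stated on the whole generic locus; the card's engine covers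
the μ-ordinary-at-λ members
(definition requested), the first foreseen split.
Lean: `∀ (ζ : (NumberField.RingOfIntegers (CyclotomicField 3 ℚ))), ζ ^ 2 + ζ + 1 = 0 → ∀ (f :
Polynomial ℤ) (hcpt : Literature.NumberTheory.Automorphic.isCompact_glFiniteIntegralLevel 3
(CyclotomicField 3 ℚ)), f.natDegree = 4 → (f.map (Int.castRingHom ℚ)).Separable → 12 ∣ Nat.card
(f.map (Int.castRingHom ℚ)).Gal → ∃ (e : CyclotomicField 3 ℚ →+* ℂ) (π :
Literature.NumberTheory.Automorphic.CuspidalAutomorphicRepData 3 (CyclotomicField 3 ℚ) hcpt),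
π.1.IsLAlgebraic ∧ ∀ᶠ 𝔭 : IsDedekindDomain.HeightOneSpectrum (NumberField.RingOfIntegers
(CyclotomicField 3 ℚ)) in Filter.cofinite, ∃ α : Multiset ℂ, π.1.HasSatakeParamAt 𝔭 α ∧ α.sum = e
((-(∑ᶠ x : (NumberField.RingOfIntegers (CyclotomicField 3 ℚ)) ⧸ 𝔭.asIdeal, (∑ j ∈ Finset.range 3,
(if (Ideal.Quotient.mk 𝔭.asIdeal) (ζ ^ j) = (f.map ((Ideal.Quotient.mk 𝔭.asIdeal).comp (algebraMap ℤ
(NumberField.RingOfIntegers (CyclotomicField 3 ℚ))))).eval x ^ ((𝔭.residueCard - 1) / 3) then ζ ^ j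
else 0)))) : (NumberField.RingOfIntegers (CyclotomicField 3 ℚ)))`

## Assembly
Pure logic: for generic f the real-root count of f is 2 (ResidualAutomorphyOdd) or not 2
(ResidualAutomorphyEven), giving the
residual hypothesis of MuOrdinaryFamilyRT; its conclusion is the hypothesis of
IrregularClassicality, whose conclusion is X.
`example : Assembly` is checked in Sketch.lean (unfold + by_cases). X is a (B)-slice: it does not
imply `Langlands`; the
complement (non-Picard ρ, other n, other fields) is the rest of the summit and is not claimed.

Rationale: WHY THIS LINE. Mechanism (card picard-branch-point-residual): at the RAMIFIED prime λ = (1−ω) of K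
the residual representation J(C)[λ] is the
branch-point module F₃[roots of f]/diagonal = the reflection representation of Gal(f) ⊂ S₄ ≅
PGL₂(F₃) (Poonen–Schaefer; Upton2009),
so residual automorphy in REGULAR weight over K is free for every generic Picard curve over ℚ, in
both archimedean parities: odd
(two real roots) by Langlands–Tunnell + Deligne–Serre + Gelbart–Jacquet Sym² + Arthur–Clozel base
change (Langlands1980,
Tunnell1981, DeligneSerreASENS1974, GelbartJacquet1978, ArthurClozelAMS120), even (0 or 4 real
roots) by JPSS non-normal cubic
induction from the CM sextic K₃(ω) of a Teichmüller-adjusted algebraic Hecke character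
(JPSS1981Cubique). The lifting is the
Boxer–Calegari–Gee–Pilloni irregular-weight machine (BoxerEtAl2021,
BCGP2025ModularityAbelianSurfaces: higher Hida theory,
R = T in irregular weight, Sen-theoretic classicality) transplanted from GSp₄ to the Picard modular
surface GU(2,1)_{ℚ(ω)/ℚ},
which IS the moduli of Picard Jacobians (Picard–Deligne–Mostow), at p = 3 where it must run
μ-ordinarily at a ramified prime
(Picard curves are never ordinary at λ: Deuring–Šafarevič; special fibres y³−y = x⁴ or x y³ − x y =
g(x), BouwEtAl2020 Prop. 30;
Pappas–Rapoport models and ramified μ-ordinary Hasse invariants: BijakowskiHernandez2022,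
BrascaRosso2021; higher Hida on GU(2,1):
Nguyen, doi:10.70675/6b01df2dze21dz40a6zb910z23a13a2cf761). Imported areas: arithmetic geometry of
superelliptic curves
(branch-point torsion, cubic character sums) and p-adic automorphic forms on unitary Shimura
varieties. No prior route exists on
this summit; the negatives index is empty. The cruxes are typed in OUTPUT form (Galois/automorphic
statements about the family in
the a.e.-Satake language) because the technology (integral models, coherent cohomology, Hida
complexes) is not in Lean; every
constant was checked with lean search and the whole Sketch.lean elaborates (lean check rc 0,
2026-08-15).

RANKED CRUXES. #0 PicardAutomorphy (target) — X above: every Picard curve y³ = f(x), f ∈ ℤ[X]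
separable quartic with Gal(f) ∈ {A₄,S₄}, is automorphic over ℚ(ω): ∃ e : K →+* ℂ and a cuspidal
L-algebraic π on GL₃(𝔸_K) with Σ(Satake at 𝔭) = e(a_𝔭(f)) for almost all 𝔭 (card P1–P5, assembly).
(why it might fail: False only with a failure of reciprocity for a Picard motive; as TYPED it fails
if the trace convention is off (sign of a_𝔭, L- vs C-normalisation, χ vs χ̄ — the last absorbed by ∃
e); BranchPointCongruence calibrates the sign; supersingular-at-λ members have no engine.)
[Upton2009, BuzzardGeeLMS2014, BCGP2025ModularityAbelianSurfaces, BouwEtAl2020]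
#2 MuOrdinaryFamilyRT (crux) — (card P2+P3, output form: μ-ordinary higher Hida family + R^{μ-ord} =
T at the ramified prime λ) For generic f: if ρ̄_{C,λ} is residually automorphic in regular weight —
some regular algebraic cuspidal P on GL₃(𝔸_K) and a prime 𝔐 ∣ 3 of ℤ̄ such that for almost all 𝔭 the
Hecke polynomial ∏(X − N𝔭·α_j) of P at 𝔭 has ℤ̄-coefficients and reduces mod 𝔐 to the branch-point
(reflection) characteristic polynomial of Frob_𝔭, i.e. (X−1)³, (X−1)²(X+1), X³−1, (X−1)(X+1)²,
X³+X²+X+1 according as f mod 𝔭 has 4, 2, 1 roots, or 0 roots with square resp. non-square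
discriminant — then ρ_C is a 3-ADIC LIMIT of regular algebraic cuspidal automorphic representations:
∃ e, 𝔐, finite S such that for every k there is a regular algebraic cuspidal P_k with
N𝔭·ΣSatake(P_k,𝔭) ≡ e(a_𝔭(f)) mod 3^k ℤ̄_𝔐 for all 𝔭 ∉ S. [deps: ResidualAutomorphyEven,
ResidualAutomorphyOdd] [difficulty: open-problem] (why it might fail: HT {0,0,1}: never ordinary at
λ (3-rank ≤ 2), λ = 3 ramified in K and 3 ∣ #S₄: μ-ordinary higher-Hida complex on the Pappas model,
Galois reps into its Hecke algebra and TW patching with non-adequate image must all be built;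
supersingular-at-λ curves have no family at all.) [BCGP2025ModularityAbelianSurfaces, BoxerEtAl2021,
BijakowskiHernandez2022, BrascaRosso2021, doi:10.70675/6b01df2dze21dz40a6zb910z23a13a2cf761,
arXiv:1412.5494, Chenevier2011, CalegariGeraghty2017, BouwEtAl2020]
#3 IrregularClassicality (crux) — (card P4, output form: classicality in irregular weight at λ) For
generic f: if ρ_C is a 3-adic limit of regular algebraic cuspidal automorphic representations in the
sense above, then C is automorphic (conclusion of the target: cuspidal L-algebraic π with Satake
traces e(a_𝔭(f)) a.e.). [deps: MuOrdinaryFamilyRT] [difficulty: open-problem] (why it might fail: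
BCGP prove Sen = Cousin classicality only for p split completely and say other cases "will require
new ideas" (arXiv:2502.20645 p.3); here p = 3 is ramified in K, and the typed waypoint forgets level
and slope at λ, so it may be harder than the eigenvariety statement it abstracts.)
[BCGP2025ModularityAbelianSurfaces, BoxerPilloni2021HigherColeman, GoldringKoskivirta2019,
arXiv:1412.5494, Chenevier2011]
#4 ResidualAutomorphyEven (crux) — (card P1, even branch) For generic f with 0 or 4 real roots
(complex conjugation even, resolvent cubic field K₃ totally real, K₃(ω) CM): there is a regular
algebraic cuspidal P on GL₃(𝔸_K) and 𝔐 ∣ 3 whose Hecke polynomials reduce mod 𝔐 to the branch-point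
characteristic polynomials a.e. — intended P = AI_{K₃(ω)/K}(χψ), χ the quadratic character cutting
out the splitting field over K₃(ω), ψ algebraic of regular type with trivial reduction (Teichmüller
adjustment), twisted to absorb sgn. [difficulty: L] (why it might fail: Needs ψ on the CM sextic
K₃(ω) with ψ̄ = 1 mod 𝔐, HT types {0,1,2} above each embedding of K and ψψ^c through N, so that the
non-normal cubic induction is cuspidal, regular algebraic, polarizable; the congruence must hold for
CHARACTERISTIC POLYNOMIALS (Brauer–Nesbitt, char 3, dim 3).) [JPSS1981Cubique, ArthurClozelAMS120,
Upton2009, HarrisLanTaylorThorneRMS2016]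
#9 ResidualAutomorphyOdd (support) — (card P1, odd branch; theorem-sized) For generic f with exactly
two real roots: σ̄ : G_ℚ → GL₂(F̄₃) lifting the projective S₄/A₄ representation is odd;
Langlands–Tunnell + Deligne–Serre/Gelbart Steps 4–5 give an ordinary weight-2 g ≡ σ̄; Sym² g
(Gelbart–Jacquet) is cuspidal (g non-CM as the projective image is S₄/A₄); BC_{K/ℚ}(Sym² g) ⊗
(finite character) is regular algebraic cuspidal on GL₃(𝔸_K) with r̄ = Ad⁰σ̄ ⊗ det σ̄ ≡ reflection ⊗
χ̄₃, and χ̄₃ ∣ G_K = 1: its Hecke polynomials reduce mod 𝔐 to the branch-point characteristic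
polynomials a.e. [difficulty: L] [Langlands1980, Tunnell1981, DeligneSerreASENS1974,
GelbartJacquet1978, Gelbart1997, ArthurClozelAMS120, Wiles1995Annals]
#9 BranchPointCongruence (support) — (elementary shadow of J[1−ω] ≅ reflection module; calibrates
the sign convention of a_𝔭) For every f ∈ ℤ[X], every primitive cube root ζ ∈ 𝓞_K and every finite 𝔭
∤ 3 with f ≢ 0 mod 𝔭: a_𝔭(f) ≡ #{x ∈ k_𝔭 : f(x) = 0} − 1 (mod (1 − ζ)). Proof: N𝔭 ≡ 1 mod 3, χ_𝔭(a)
is exactly one cube root of unity for a ≠ 0 (≡ 1 mod 1−ζ) and 0 for a = 0, so Σχ_𝔭(f(x)) ≡ N𝔭 −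
#roots ≡ 1 − #roots. Provable now in Lean. [difficulty: provable-now] [Upton2009, BouwEtAl2020]

TWO-LAYER PLAN. Foreseen (nothing filed now): once `HasMuOrdinaryReductionAtThree` lands,
MuOrdinaryFamilyRT ⇐ RTMuOrdinary (same statement under
the hypothesis "y³ = f(x) has potentially good reduction at 3 of two-branch-point type x y³ − x y =
g(x), λ-distinguished") →
RTSupersingular (the complement; conceded by the card, kept as the honest remainder) →
MuOrdinaryFamilyRT (glue = case split).
If ResidualAutomorphyEven stalls on polarizability: split into HeckeCharacterExists (the CM
character ψ on K₃(ω)) → CubicInduction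
(JPSS AI is regular algebraic cuspidal with the right reduction) → ResidualAutomorphyEven.

KILL CRITERIA. (1) BranchPointCongruence REFUTED in Lean ⇒ the a_𝔭 convention is wrong ⇒ repair by
restating the three items that contain a_𝔭
(not a close). (2) A grounder/refuter shows from BornerBouwWewers2017/BouwEtAl2020 that
potentially-good reduction of
two-branch-point (3-rank 2) type is NOT Zariski-generic among Picard curves over ℚ₃ (e.g. generic
members reduce to y³ − y = x⁴ or
have non-compact-type reduction) ⇒ MuOrdinaryFamilyRT loses its engine for most curves ⇒ pivot to
finite-slope (higher Coleman,
BoxerPilloni2021HigherColeman) or close `exhausted` with census. (3) ResidualAutomorphyEven refuted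
as typed (no regular algebraic
cuspidal P with those reductions for some even f) ⇒ restate the target to the odd half (roots.card =
2) and drop the even crux.
(4) A published automorphy theorem for generic Picard curves (any method) ⇒ close `superseded/known`
(searched 2026-08-15: none).
(5) IrregularClassicality and MuOrdinaryFamilyRT are implied by reciprocity, so they close only
`exhausted`, never `refuted`,
unless the typing is wrong — refuters should attack the normalisations (N𝔭·Σα for regular algebraic
P per lang.S27; Σα for
L-algebraic π per the summit's SatakeFrobCompatibleAt).

NOT DECOMPOSED YET. The technology inside MuOrdinaryFamilyRT — Pappas–Krämer integral model of the
Picard surface at 3, the μ-ordinary (3-rank-2)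
stratum and its Hasse invariant at a RAMIFIED prime, the perfect higher-Hida complex in degrees
[0,1] with control in weight (1,0),
Galois representations (incl. torsion) valued in its Hecke algebra, Taylor–Wiles patching of
complexes with image S₄/A₄ ⊂ GL₃(F₃)
(adequacy by hand, 3 ∣ 24), the P-ordinary local deformation ring at λ — and inside
IrregularClassicality — Sen operator on the
perfectoid Picard surface, p-adic Eichler–Shimura for U(2,1) at ramified p, multiplicity one for the
Hida family. Also not
decomposed: the upgrade from a.e.-Satake matching to the summit's all-places `Corresponds` (LGC at
ramified places and at λ for an
irregular π; GoldringKoskivirta2019 gives only a.e.) — shared by every (B)-slice and not attempted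
here; the ladder y^ℓ = f₄
(ℓ ≥ 5); Picard curves with Gal(f) ∈ {D₄, V₄, C₄} (residually reducible) and the (1−ω)-supersingular
locus.

CHEAPEST FALSIFIER. (a) Lookup, 30 min: BouwEtAl2020 Prop. 30 (read: arXiv:1902.09624 p. 8) lists
the two good special fibres in characteristic 3,
y³ − y = x⁴ (one branch point, 3-rank 0, a SINGLE curve) and x y³ − x y = g(x) (two branch points,
3-rank 2, a family) — so the
μ-ordinary type exists and has moduli; what remains to check in BornerBouwWewers2017 (Cases (a)–(e))
is that Case (a) with two branch
points is attained by S₄-quartics over ℚ (their tables of small-conductor Picard curves). (b)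
Computation, an afternoon
(`kit compute`): for f = x⁴ + x + 1 (disc 229, S₄) tabulate a_𝔭(f) for N𝔭 < 500, confirm a_𝔭 ≡
#roots − 1 mod (1−ω)
(BranchPointCongruence) and |e(a_𝔭)| ≤ 3·N𝔭^{1/2}, and compare N𝔭·tr with the Hecke eigenvalues of
BC(Sym² g) for the weight-2
level-3·229-ish form g predicted by ResidualAutomorphyOdd mod 3 (LMFDB). Not run here (hub
compute-free; left to the refuter).

NUMBERS. Genus 3; rank 3 over ℤ[ω]; signature (2,1); HT weights {0,0,1}/{0,1,1}; residual image S₄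
(24) or A₄ (12) on F₃³, 3 ∣ 24;
3-rank of a good characteristic-3 fibre ∈ {0, 2} (never 3); conductor exponent f₃ ≥ 6 in the
potentially good case
(BouwEtAl2020 Rem. 72); BCGP 2025 need p ∈ {2,3} and p split for classicality (arXiv:2502.20645 p.
3).

DEFINITION REQUESTS. (D1) `HasMuOrdinaryReductionAtThree (f : Polynomial ℤ) : Prop` — y³ = f(x) has
potentially good reduction at 3 whose good
model over ℤ̄₃ has special fibre of two-branch-point type x y³ − x y = g(x) (3-rank 2), and
Frobenius on the rank-2 unit-root
part has distinct eigenvalues (λ-distinguished); source BouwEtAl2020 Prop. 30, BornerBouwWewers2017;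
topic
Literature/AlgebraicGeometry/Motives (next to GoodReduction). Needed for the first split of
MuOrdinaryFamilyRT.
(D2) `cubicResidueSymbol` for 𝓞_K = ℤ[ω] (Ireland–Rosen Ch. 9) and `picardTrace f 𝔭` — would shrink
every signature here;
topic Literature/NumberTheory/GaloisRepresentations. Cite facts wanted as hypotheses:
JPSS1981Cubique non-normal cubic
automorphic induction for unitary algebraic Hecke characters (the tree's
`automorphicInduction_character` is Galois prime degree,
finite order only); Deligne–Serre lemma (DeligneSerreASENS1974 Lemme 6.11).

Novelty: Searches (2026-08-15): crossref "Picard curves conductor discriminant" (BouwEtAl2020,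
BornerBouwWewers2017), "mu-ordinary Hasse
invariants Pappas Rapoport ramified unitary" (BijakowskiHernandez2022, Bijakowski 2016 ANT, Zachos
2024), "higher Hida theory
unitary group GU(2,1)" (Nguyen thesis doi:10.70675/6b01…; Fu "Level lowering … Picard modular
surfaces"; BoxerPilloni Invent.
2025), "Galois representations attached to Picard curves automorphy" (Upton2009; Ghitza–Yamauchi
mod-2 genus 2; nothing on
Picard automorphy), "automorphy lifting irregular weight unitary …" (Thorne 2-adic;
BrascaRosso2021), "Pacetti Villanueva
superelliptic" (doi:10.1017/s0017089522000386, Goodman 2025 large images); galaxy --star all "Picard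
modular surface" (24 rows:
Morel, Bajpai–Cavicchi Eisenstein cohomology, Joyner period polynomials — no lifting), "Picard
curves" (cryptography, CM quartics,
Sutherland counting), "higher Hida theory unitary group GU(2,1)" (0); lit frontier Langlands --since
2020 (arXiv:2602.04778 R=T for
orthogonal Shimura varieties; nothing on Picard curves); lit bridges Langlands --cross any (no
Picard items); read BCGP
arXiv:2502.20645 pp. 3, 5–6 and BouwEtAl2020 pp. 8, 20.
Nearest prior art found: BCGP2025ModularityAbelianSurfaces / BoxerEtAl2021 (the GSp₄
irregular-weight template, p split,
residual input via 2–3 switch and odd icosahedral Artin); Upton2009 and Poonen–Schaefer 1997 (J[1−ω]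
= branch-point module is
standard); BijakowskiHernandez2022 + BrascaRosso2021 + Nguyen  [refs: 10.70675/6b01…, 10.1017/s0017089522000386, 2602.04778, 2502.20645, doi:10.70675/6b01, doi:10.1017/s0017089522000386, BouwEtAl2020, BornerBouwWewers2017, BijakowskiHernandez2022, Upton2009, BrascaRosso2021, BoxerEtAl2021]

Barriers (technique_class: higher-hida irregular-weight automorphy-lifting): - technique_class: higher-hida irregular-weight automorphy-lifting
- Literature.Barriers.Langlands.NonRegularWeightBarrier: met by design (HT {0,0,1}) and evaded along
its recorded evasion: coherent cohomology of the Picard modular surface in degrees 0 and 1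
(limit-of-discrete-series weight) + higher Hida theory + Sen-theoretic classicality, never Betti
cohomology; nothing is claimed for the fourth form (Maass-type weights).
- Literature.Barriers.Langlands.TaylorWilesNumericalCoincidence: the irregular weight lowers the
p-adic term (scope caveat (b)) — handled as in BCGP by patching length-1 higher-Hida COMPLEXES
(Calegari–Geraghty positive defect), not single modules; the coincidence is not needed in the form
the barrier kills.
- Literature.Barriers.Langlands.TaylorWilesNumericalCoincidenceNarrow: satisfied — the deformation
problem is polarized over the totally real base ℚ (GU(2,1)_{ℚ(ω)/ℚ}, r^c ≅ r^∨ ⊗ χ from the Weil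
pairing and the ℤ[ω]-action), totally odd; nothing is patched over a field with complex places as
base.
- Literature.Barriers.Langlands.PatchingLocalComponentBarrier: at λ the local condition is
P-(μ-)ordinary, a single irreducible component of the local deformation ring; curves outside the
μ-ordinary λ-distinguished locus are conceded (foreseen split RTSupersingular), not claimed to be
reached by patching.
- Literature.Barriers.Langlands.ResiduallyReducibleBarrier: the residual image S₄/A₄ on F₃³ is
absolutely irreducible but 3 ∣ #image, so adequacy fails in

History (route lifecycle, newest last):
- 2026-08-15T13:48:44Z · CLOSED retired — not-a-thesis: assembly does not conclude the sub-problem Statement (operator:999:1257524)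

sub-problem: Langlands · status: closed(retired) · opened planner-plancard-Langlands-Langlands-picard-b-7dd739e6-0 2026-08-15T11:07:50Z · rev 1 · ledger route-Langlands-PicardBranchPoint
GENERATED by the gate from the ledger (D-0016/17). Provers cite these decls: `theorem foo : Summit.Langlands.Langlands.Theses.PicardBranchPoint.<Decl> := …` in Summits/Langlands/Langlands/Theorems/<Name>.lean.
-/

namespace Summit.Langlands.Langlands.Theses.PicardBranchPoint

open scoped BigOperators Topology Manifold Classical MeasureTheory ProbabilityTheory Matrix InnerProductSpace ComplexConjugate ContinuousMap
open Filter Set Function TopologicalSpace MeasureTheory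

attribute [summit_statement] _root_.Langlands

/-- item stmt-Langlands-2768 · target · rank 0 · closed · moot by None · by planner
why it might fail: Open (B)-slice of reciprocity; refutable only via typing: sign/χ-vs-χ̄ of a_𝔭 (∃ e absorbs conjugation; BranchPointCongruence fixes the sign), and π must be the non-unitary L-algebraic twist with Σα = weight-1 Frobenius trace (summit m=1). ∀ generic f includes λ-supersingular members with no engine.
sources: Upton2009, PoonenSchaefer1997, BuzzardGeeLMS2014, BCGP2025ModularityAbelianSurfaces, BouwEtAl2020, arXiv:2511.04609
[target] X above: every Picard curve y³ = f(x), f ∈ ℤ[X] separable quartic with Gal(f) ∈ {A₄,S₄}, is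
automorphic over ℚ(ω): ∃ e : K →+* ℂ and a cuspidal L-algebraic π on GL₃(𝔸_K) with Σ(Satake at 𝔭) =
e(a_𝔭(f)) for almost all 𝔭 (card P1–P5, assembly). -/
@[route_item "route-Langlands-PicardBranchPoint"]
def PicardAutomorphy : Prop :=
  ∀ (ζ : (NumberField.RingOfIntegers (CyclotomicField 3 ℚ))), ζ ^ 2 + ζ + 1 = 0 → ∀ (f : Polynomial ℤ) (hcpt : Literature.NumberTheory.Automorphic.isCompact_glFiniteIntegralLevel 3 (CyclotomicField 3 ℚ)), f.natDegree = 4 → (f.map (Int.castRingHom ℚ)).Separable → 12 ∣ Nat.card (f.map (Int.castRingHom ℚ)).Gal → ∃ (e : CyclotomicField 3 ℚ →+* ℂ) (π : Literature.NumberTheory.Automorphic.CuspidalAutomorphicRepData 3 (CyclotomicField 3 ℚ) hcpt), π.1.IsLAlgebraic ∧ ∀ᶠ 𝔭 : IsDedekindDomain.HeightOneSpectrum (NumberField.RingOfIntegers (CyclotomicField 3 ℚ)) in Filter.cofinite, ∃ α : Multiset ℂ, π.1.HasSatakeParamAt 𝔭 α ∧ α.sum = e ((-(∑ᶠ x : (NumberField.RingOfIntegers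 (CyclotomicField 3 ℚ)) ⧸ 𝔭.asIdeal, (∑ j ∈ Finset.range 3, (if (Ideal.Quotient.mk 𝔭.asIdeal) (ζ ^ j) = (f.map ((Ideal.Quotient.mk 𝔭.asIdeal).comp (algebraMap ℤ (NumberField.RingOfIntegers (CyclotomicField 3 ℚ))))).eval x ^ ((𝔭.residueCard - 1) / 3) then ζ ^ j else 0)))) : (NumberField.RingOfIntegers (CyclotomicField 3 ℚ)))

/-- item stmt-Langlands-2769 · crux · rank 2 · closed · moot by None · by planner
why it might fail: ∀ generic f, incl. curves μ-ordinary/K_λ only after wild extension (types at ramified λ) or pot. supersingular (y³−y=x⁴: no Hida family; mod-3^k congruence to regular eigenforms not implied by reciprocity: may be FALSE); else higher Hida + R=T on ramified Pappas–Rapoport model, 3∣#S₄ (BCGP: ord.)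
sources: BCGP2025ModularityAbelianSurfaces, BoxerEtAl2021, BijakowskiHernandez2022, BrascaRosso2021, CalegariGeraghty2017, Chenevier2011
[crux] (card P2+P3, output form: μ-ordinary higher Hida family + R^{μ-ord} = T at the ramified prime
λ) For generic f: if ρ̄_{C,λ} is residually automorphic in regular weight — some regular algebraic
cuspidal P on GL₃(𝔸_K) and a prime 𝔐 ∣ 3 of ℤ̄ such that for almost all 𝔭 the Hecke polynomial ∏(X −
N𝔭·α_j) of P at 𝔭 has ℤ̄-coefficients and reduces mod 𝔐 to the branch-point (reflection)
characteristic polynomial of Frob_𝔭, i.e. (X−1)³, (X−1)²(X+1), X³−1, (X−1)(X+1)², X³+X²+X+1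
according as f mod 𝔭 has 4, 2, 1 roots, or 0 roots with square resp. non-square discriminant — then
ρ_C is a 3-ADIC LIMIT of regular algebraic cuspidal automorphic representations: ∃ e, 𝔐, finite S
such that for every k there is a regular algebraic cuspidal P_k with N𝔭·ΣSatake(P_k,𝔭) ≡ e(a_𝔭(f))
mod 3^k ℤ̄_𝔐 for all 𝔭 ∉ S. [deps: ResidualAutomorphyEven, ResidualAutomorphyOdd] [difficulty:
open-problem] -/
@[route_item "route-Langlands-PicardBranchPoint"]
def MuOrdinaryFamilyRT : Prop :=
  ∀ (ζ : (NumberField.RingOfIntegers (CyclotomicField 3 ℚ))), ζ ^ 2 + ζ + 1 = 0 → ∀ (f : Polynomial ℤ) (hcpt : Literature.NumberTheory.Automorphic.isCompact_glFiniteIntegralLevel 3 (CyclotomicField 3 ℚ)), f.natDegree = 4 → (f.map (Int.castRingHom ℚ)).Separable → 12 ∣ Nat.card (f.map (Int.castRingHom ℚ)).Gal → (∃ (P : Literature.NumberTheory.Automorphic.CuspidalAutomorphicRepData 3 (CyclotomicField 3 ℚ) hcpt) (𝔐 : Ideal (integralClosure ℤ ℂ)), P.1.IsRegularAlgebraic ∧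 𝔐.IsMaximal ∧ (3 : (integralClosure ℤ ℂ)) ∈ 𝔐 ∧ ∀ᶠ 𝔭 : IsDedekindDomain.HeightOneSpectrum (NumberField.RingOfIntegers (CyclotomicField 3 ℚ)) in Filter.cofinite, ∃ (α : Multiset ℂ) (Q : Polynomial (integralClosure ℤ ℂ)), P.1.HasSatakeParamAt 𝔭 α ∧ Q.map (algebraMap (integralClosure ℤ ℂ) ℂ) = (α.map (fun a => Polynomial.X - Polynomial.C ((𝔭.residueCard : ℂ) * a))).prod ∧ Q.map (Ideal.Quotient.mk 𝔐) = (if (f.map ((Ideal.Quotient.mk 𝔭.asIdeal).comp (algebraMap ℤ (NumberField.RingOfIntegers (CyclotomicField 3 ℚ))))).roots.toFinset.card = 4 then (Polynomial.X - 1) ^ 3 else if (f.map ((Ideal.Quotient.mk 𝔭.asIdeal).comp (algebraMap ℤ (NumberField.RingOfIntegers (CyclotomicField 3 ℚ))))).roots.toFinset.card = 2 then (Polynomial.X - 1) ^ 2 * (Polynomial.X + 1) else if (f.map ((Ideal.Quotient.mk 𝔭.asIdeal).comp (algebraMap ℤ (NumberField.RingOfIntegers (CyclotomicField 3 ℚ))))).roots.toFinset.card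 = 1 then Polynomial.X ^ 3 - 1 else if (∃ y : ((NumberField.RingOfIntegers (CyclotomicField 3 ℚ)) ⧸ 𝔭.asIdeal), y ^ 2 = (f.map ((Ideal.Quotient.mk 𝔭.asIdeal).comp (algebraMap ℤ (NumberField.RingOfIntegers (CyclotomicField 3 ℚ))))).discr) then (Polynomial.X - 1) * (Polynomial.X + 1) ^ 2 else Polynomial.X ^ 3 + Polynomial.X ^ 2 + Polynomial.X + 1 : Polynomial ℤ).map (Int.castRingHom ((integralClosure ℤ ℂ) ⧸ 𝔐))) → ∃ (e : CyclotomicField 3 ℚ →+* ℂ) (𝔐 : Ideal (integralClosure ℤ ℂ)) (S : Finset (IsDedekindDomain.HeightOneSpectrum (NumberField.RingOfIntegers (CyclotomicField 3 ℚ)))), 𝔐.IsMaximal ∧ (3 : (integralClosure ℤ ℂ)) ∈ 𝔐 ∧ ∀ k : ℕ, ∃ P : Literature.NumberTheory.Automorphic.CuspidalAutomorphicRepData 3 (CyclotomicField 3 ℚ) hcpt, P.1.IsRegularAlgebraic ∧ ∀ 𝔭 ∉ S, ∃ (α : Multiset ℂ) (t a u : (integralClosure ℤ ℂ)), P.1.HasSatakeParamAt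 𝔭 α ∧ (t : ℂ) = (𝔭.residueCard : ℂ) * α.sum ∧ (a : ℂ) = e ((-(∑ᶠ x : (NumberField.RingOfIntegers (CyclotomicField 3 ℚ)) ⧸ 𝔭.asIdeal, (∑ j ∈ Finset.range 3, (if (Ideal.Quotient.mk 𝔭.asIdeal) (ζ ^ j) = (f.map ((Ideal.Quotient.mk 𝔭.asIdeal).comp (algebraMap ℤ (NumberField.RingOfIntegers (CyclotomicField 3 ℚ))))).eval x ^ ((𝔭.residueCard - 1) / 3) then ζ ^ j else 0)))) : (NumberField.RingOfIntegers (CyclotomicField 3 ℚ))) ∧ u ∉ 𝔐 ∧ u * (t - a) ∈ Ideal.span {(3 : (integralClosure ℤ ℂ)) ^ k}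

/-- item stmt-Langlands-2770 · crux · rank 3 · closed · moot by None · by planner
why it might fail: BCGP's Sen=Cousin classicality is proved only for GSp₄ with p split completely; other cases 'will require new ideas' (arXiv:2502.20645 p.3). Here G=U(2,1), p=3 ramifies in K, and the typed hypothesis keeps only trace congruences mod 3^k (no U(2,1)-descent, level or slope at λ): family to be rebuilt.
sources: BCGP2025ModularityAbelianSurfaces, BoxerPilloni2021HigherColeman, GoldringKoskivirta2019, Chenevier2011, arXiv:1412.5494
[crux] (card P4, output form: classicality in irregular weight at λ) For generic f: if ρ_C is a
3-adic limit of regular algebraic cuspidal automorphic representations in the sense above, then C is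
automorphic (conclusion of the target: cuspidal L-algebraic π with Satake traces e(a_𝔭(f)) a.e.).
[deps: MuOrdinaryFamilyRT] [difficulty: open-problem] -/
@[route_item "route-Langlands-PicardBranchPoint"]
def IrregularClassicality : Prop :=
  ∀ (ζ : (NumberField.RingOfIntegers (CyclotomicField 3 ℚ))), ζ ^ 2 + ζ + 1 = 0 → ∀ (f : Polynomial ℤ) (hcpt : Literature.NumberTheory.Automorphic.isCompact_glFiniteIntegralLevel 3 (CyclotomicField 3 ℚ)), f.natDegree = 4 → (f.map (Int.castRingHom ℚ)).Separable → 12 ∣ Nat.card (f.map (Int.castRingHom ℚ)).Gal → (∃ (e : CyclotomicField 3 ℚ →+* ℂ) (𝔐 : Ideal (integralClosure ℤ ℂ)) (S : Finset (IsDedekindDomain.HeightOneSpectrum (NumberField.RingOfIntegers (CyclotomicField 3 ℚ)))), 𝔐.IsMaximal ∧ (3 : (integralClosure ℤ ℂ)) ∈ 𝔐 ∧ ∀ k : ℕ, ∃ P : Literature.NumberTheory.Automorphic.CuspidalAutomorphicRepData 3 (CyclotomicField 3 ℚ) hcpt, P.1.IsRegularAlgebraic ∧ ∀ 𝔭 ∉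 S, ∃ (α : Multiset ℂ) (t a u : (integralClosure ℤ ℂ)), P.1.HasSatakeParamAt 𝔭 α ∧ (t : ℂ) = (𝔭.residueCard : ℂ) * α.sum ∧ (a : ℂ) = e ((-(∑ᶠ x : (NumberField.RingOfIntegers (CyclotomicField 3 ℚ)) ⧸ 𝔭.asIdeal, (∑ j ∈ Finset.range 3, (if (Ideal.Quotient.mk 𝔭.asIdeal) (ζ ^ j) = (f.map ((Ideal.Quotient.mk 𝔭.asIdeal).comp (algebraMap ℤ (NumberField.RingOfIntegers (CyclotomicField 3 ℚ))))).eval x ^ ((𝔭.residueCard - 1) / 3) then ζ ^ j else 0)))) : (NumberField.RingOfIntegers (CyclotomicField 3 ℚ))) ∧ u ∉ 𝔐 ∧ u * (t - a) ∈ Ideal.span {(3 : (integralClosure ℤ ℂ)) ^ k}) → ∃ (e : CyclotomicField 3 ℚ →+* ℂ) (π : Literature.NumberTheory.Automorphic.CuspidalAutomorphicRepData 3 (CyclotomicField 3 ℚ) hcpt), π.1.IsLAlgebraic ∧ ∀ᶠ 𝔭 : IsDedekindDomain.HeightOneSpectrum (NumberField.RingOfIntegers (CyclotomicField 3 ℚ))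 in Filter.cofinite, ∃ α : Multiset ℂ, π.1.HasSatakeParamAt 𝔭 α ∧ α.sum = e ((-(∑ᶠ x : (NumberField.RingOfIntegers (CyclotomicField 3 ℚ)) ⧸ 𝔭.asIdeal, (∑ j ∈ Finset.range 3, (if (Ideal.Quotient.mk 𝔭.asIdeal) (ζ ^ j) = (f.map ((Ideal.Quotient.mk 𝔭.asIdeal).comp (algebraMap ℤ (NumberField.RingOfIntegers (CyclotomicField 3 ℚ))))).eval x ^ ((𝔭.residueCard - 1) / 3) then ζ ^ j else 0)))) : (NumberField.RingOfIntegers (CyclotomicField 3 ℚ)))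

/-- item stmt-Langlands-2771 · support · rank 4 · closed · moot by None · by planner
why it might fail: Needs ψ on the CM sextic K₃(ω) with ψ̄ = 1 mod 𝔐, HT types {0,1,2} above each embedding of K and ψψ^c through N, so that the non-normal cubic induction is cuspidal, regular algebraic, polarizable; the congruence must hold for CHARACTERISTIC POLYNOMIALS (Brauer–Nesbitt, char 3, dim 3).
sources: JPSS1981Cubique, ArthurClozelAMS120, SerreAbelianLadic1968, PoonenSchaefer1997, Upton2009
[crux] (card P1, even branch) For generic f with 0 or 4 real roots (complex conjugation even,
resolvent cubic field K₃ totally real, K₃(ω) CM): there is a regular algebraic cuspidal P on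
GL₃(𝔸_K) and 𝔐 ∣ 3 whose Hecke polynomials reduce mod 𝔐 to the branch-point characteristic
polynomials a.e. — intended P = AI_{K₃(ω)/K}(χψ), χ the quadratic character cutting out the
splitting field over K₃(ω), ψ algebraic of regular type with trivial reduction (Teichmüller
adjustment), twisted to absorb sgn. [difficulty: L] -/
@[route_item "route-Langlands-PicardBranchPoint"]
def ResidualAutomorphyEven : Prop :=
  ∀ (f : Polynomial ℤ) (hcpt : Literature.NumberTheory.Automorphic.isCompact_glFiniteIntegralLevel 3 (CyclotomicField 3 ℚ)), f.natDegree = 4 → (f.map (Int.castRingHom ℚ)).Separable → 12 ∣ Nat.card (f.map (Int.castRingHom ℚ)).Gal → (f.map (Int.castRingHom ℝ)).roots.card ≠ 2 → ∃ (P : Literature.NumberTheory.Automorphic.CuspidalAutomorphicRepData 3 (CyclotomicField 3 ℚ) hcpt) (𝔐 : Ideal (integralClosure ℤ ℂ)), P.1.IsRegularAlgebraic ∧ 𝔐.IsMaximal ∧ (3 : (integralClosure ℤ ℂ)) ∈ 𝔐 ∧ ∀ᶠ 𝔭 : IsDedekindDomain.HeightOneSpectrum (NumberField.RingOfIntegers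 (CyclotomicField 3 ℚ)) in Filter.cofinite, ∃ (α : Multiset ℂ) (Q : Polynomial (integralClosure ℤ ℂ)), P.1.HasSatakeParamAt 𝔭 α ∧ Q.map (algebraMap (integralClosure ℤ ℂ) ℂ) = (α.map (fun a => Polynomial.X - Polynomial.C ((𝔭.residueCard : ℂ) * a))).prod ∧ Q.map (Ideal.Quotient.mk 𝔐) = (if (f.map ((Ideal.Quotient.mk 𝔭.asIdeal).comp (algebraMap ℤ (NumberField.RingOfIntegers (CyclotomicField 3 ℚ))))).roots.toFinset.card = 4 then (Polynomial.X - 1) ^ 3 else if (f.map ((Ideal.Quotient.mk 𝔭.asIdeal).comp (algebraMap ℤ (NumberField.RingOfIntegers (CyclotomicField 3 ℚ))))).roots.toFinset.card = 2 then (Polynomial.X - 1) ^ 2 * (Polynomial.X + 1) else if (f.map ((Ideal.Quotient.mk 𝔭.asIdeal).comp (algebraMap ℤ (NumberField.RingOfIntegers (CyclotomicField 3 ℚ))))).roots.toFinset.card = 1 then Polynomial.X ^ 3 - 1 else if (∃ y : ((NumberField.RingOfIntegers (CyclotomicField 3 ℚ)) ⧸ 𝔭.asIdeal), y ^ 2 =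 (f.map ((Ideal.Quotient.mk 𝔭.asIdeal).comp (algebraMap ℤ (NumberField.RingOfIntegers (CyclotomicField 3 ℚ))))).discr) then (Polynomial.X - 1) * (Polynomial.X + 1) ^ 2 else Polynomial.X ^ 3 + Polynomial.X ^ 2 + Polynomial.X + 1 : Polynomial ℤ).map (Int.castRingHom ((integralClosure ℤ ℂ) ⧸ 𝔐))

/-- item stmt-Langlands-2772 · support · rank 9 · closed · moot by None · by planner
sources: Langlands1980, Tunnell1981, DeligneSerreASENS1974, GelbartJacquet1978, Gelbart1997, ArthurClozelAMS120
[support] (card P1, odd branch; theorem-sized) For generic f with exactly two real roots: σ̄ : G_ℚ →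
GL₂(F̄₃) lifting the projective S₄/A₄ representation is odd; Langlands–Tunnell +
Deligne–Serre/Gelbart Steps 4–5 give an ordinary weight-2 g ≡ σ̄; Sym² g (Gelbart–Jacquet) is
cuspidal (g non-CM as the projective image is S₄/A₄); BC_{K/ℚ}(Sym² g) ⊗ (finite character) is
regular algebraic cuspidal on GL₃(𝔸_K) with r̄ = Ad⁰σ̄ ⊗ det σ̄ ≡ reflection ⊗ χ̄₃, and χ̄₃ ∣ G_K =
1: its Hecke polynomials reduce mod 𝔐 to the branch-point characteristic polynomials a.e.
[difficulty: L] -/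
@[route_item "route-Langlands-PicardBranchPoint"]
def ResidualAutomorphyOdd : Prop :=
  ∀ (f : Polynomial ℤ) (hcpt : Literature.NumberTheory.Automorphic.isCompact_glFiniteIntegralLevel 3 (CyclotomicField 3 ℚ)), f.natDegree = 4 → (f.map (Int.castRingHom ℚ)).Separable → 12 ∣ Nat.card (f.map (Int.castRingHom ℚ)).Gal → (f.map (Int.castRingHom ℝ)).roots.card = 2 → ∃ (P : Literature.NumberTheory.Automorphic.CuspidalAutomorphicRepData 3 (CyclotomicField 3 ℚ) hcpt) (𝔐 : Ideal (integralClosure ℤ ℂ)), P.1.IsRegularAlgebraic ∧ 𝔐.IsMaximal ∧ (3 : (integralClosure ℤ ℂ)) ∈ 𝔐 ∧ ∀ᶠ 𝔭 : IsDedekindDomain.HeightOneSpectrum (NumberField.RingOfIntegers (CyclotomicField 3 ℚ)) in Filter.cofinite, ∃ (α : Multiset ℂ) (Q : Polynomial (integralClosure ℤ ℂ)), P.1.HasSatakeParamAt 𝔭 α ∧ Q.map (algebraMap (integralClosure ℤ ℂ) ℂ) = (α.map (fun a => Polynomial.X - Polynomial.C ((𝔭.residueCard : ℂ) * a))).prod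 ∧ Q.map (Ideal.Quotient.mk 𝔐) = (if (f.map ((Ideal.Quotient.mk 𝔭.asIdeal).comp (algebraMap ℤ (NumberField.RingOfIntegers (CyclotomicField 3 ℚ))))).roots.toFinset.card = 4 then (Polynomial.X - 1) ^ 3 else if (f.map ((Ideal.Quotient.mk 𝔭.asIdeal).comp (algebraMap ℤ (NumberField.RingOfIntegers (CyclotomicField 3 ℚ))))).roots.toFinset.card = 2 then (Polynomial.X - 1) ^ 2 * (Polynomial.X + 1) else if (f.map ((Ideal.Quotient.mk 𝔭.asIdeal).comp (algebraMap ℤ (NumberField.RingOfIntegers (CyclotomicField 3 ℚ))))).roots.toFinset.card = 1 then Polynomial.X ^ 3 - 1 else if (∃ y : ((NumberField.RingOfIntegers (CyclotomicField 3 ℚ)) ⧸ 𝔭.asIdeal), y ^ 2 = (f.map ((Ideal.Quotient.mk 𝔭.asIdeal).comp (algebraMap ℤ (NumberField.RingOfIntegers (CyclotomicField 3 ℚ))))).discr) then (Polynomial.X - 1) * (Polynomial.X + 1) ^ 2 else Polynomial.X ^ 3 + Polynomial.X ^ 2 + Polynomial.X + 1 : Polynomial ℤ).map (Int.castRingHom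 ((integralClosure ℤ ℂ) ⧸ 𝔐))

/-- item stmt-Langlands-2773 · support · rank 9 · closed · moot by None · by planner
sources: Upton2009, BouwEtAl2020
[support] (elementary shadow of J[1−ω] ≅ reflection module; calibrates the sign convention of a_𝔭)
For every f ∈ ℤ[X], every primitive cube root ζ ∈ 𝓞_K and every finite 𝔭 ∤ 3 with f ≢ 0 mod 𝔭:
a_𝔭(f) ≡ #{x ∈ k_𝔭 : f(x) = 0} − 1 (mod (1 − ζ)). Proof: N𝔭 ≡ 1 mod 3, χ_𝔭(a) is exactly one cube
root of unity for a ≠ 0 (≡ 1 mod 1−ζ) and 0 for a = 0, so Σχ_𝔭(f(x)) ≡ N𝔭 − #roots ≡ 1 − #roots.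
Provable now in Lean. [difficulty: provable-now] -/
@[route_item "route-Langlands-PicardBranchPoint"]
def BranchPointCongruence : Prop :=
  ∀ (ζ : (NumberField.RingOfIntegers (CyclotomicField 3 ℚ))) (f : Polynomial ℤ) (𝔭 : IsDedekindDomain.HeightOneSpectrum (NumberField.RingOfIntegers (CyclotomicField 3 ℚ))), ζ ^ 2 + ζ + 1 = 0 → (3 : (NumberField.RingOfIntegers (CyclotomicField 3 ℚ))) ∉ 𝔭.asIdeal → (f.map ((Ideal.Quotient.mk 𝔭.asIdeal).comp (algebraMap ℤ (NumberField.RingOfIntegers (CyclotomicField 3 ℚ))))) ≠ 0 → (-(∑ᶠ x : (NumberField.RingOfIntegers (CyclotomicField 3 ℚ)) ⧸ 𝔭.asIdeal, (∑ j ∈ Finset.range 3, (if (Ideal.Quotient.mk 𝔭.asIdeal) (ζ ^ j) = (f.map ((Ideal.Quotient.mk 𝔭.asIdeal).comp (algebraMap ℤ (NumberField.RingOfIntegers (CyclotomicField 3 ℚ))))).eval x ^ ((𝔭.residueCard - 1) / 3) then ζ ^ j else 0)))) - ((((f.map ((Ideal.Quotient.mk 𝔭.asIdeal).comp (algebraMap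 ℤ (NumberField.RingOfIntegers (CyclotomicField 3 ℚ))))).roots.toFinset.card : ℕ) : (NumberField.RingOfIntegers (CyclotomicField 3 ℚ))) - 1) ∈ Ideal.span {(1 : (NumberField.RingOfIntegers (CyclotomicField 3 ℚ))) - ζ}

/-- item stmt-Langlands-2774 · assembly · rank 1 · closed · moot by None · by planner
sources: BCGP2025ModularityAbelianSurfaces
[assembly] ResidualAutomorphyOdd → ResidualAutomorphyEven → MuOrdinaryFamilyRT →
IrregularClassicality → PicardAutomorphy (target X). -/
@[route_item "route-Langlands-PicardBranchPoint"]
def Assembly : Prop :=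
  ResidualAutomorphyOdd → ResidualAutomorphyEven → MuOrdinaryFamilyRT → IrregularClassicality → PicardAutomorphy

end Summit.Langlands.Langlands.Theses.PicardBranchPoint
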